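import Summits.HodgeConjecture.CorCM.GaloisTwentyFourDegenerateModels
import Mathlib.GroupTheory.SpecificGroups.Quaternion
import HarnessLib

/-!
# `Gal(K/ℚ) ≅ Q₁₆ × C₃` is BAD: a simple DEGENERATE CM abelian 24-fold (first instance of the row `Q_{2^k} × C_p`, `k ≥ 4`)

COR-CM (cell `pub-hodgecm2`), binder seat b04 (gen 32), count-neutral own lane «Galois-CM-type classification» (blanket
`CorCM/GaloisQuaternion*`, b04).  HC_CM is NOT proved here; an unconditional negative-side example.  KERNEL ONLY: theorems
(`decide` certificates); no definition, no named fact, no `sorry`.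

`Q₁₆ × C₃` (`Q₁₆ = QuaternionGroup 4`, complex conjugation the unique central involution `(a 4, 1)`; `K` = a `Q₁₆`-CM field times a
real cyclic cubic field) has all its proper CM quotients GOOD (`Q₁₆`, gen 20) and all its involutions central, so neither the
monotonicity theorem (`CorCM/GaloisDegenerateMonotone`) nor the skew-section theorem (`CorCM/GaloisNonCentralInvolution`) applies:
it is an ARITHMETIC instance, like `Q₈ × C₃` (gen 25).  The seat's random search (compute j226125: 3 degenerate among 221 primitive
samples, Kubota rank `17 < 25`) found the type below; its annihilator is `±1` on `12` elements, i.e. a balanced set `D` of SIX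
elements in gen 20's format (`exists_simple_degenerate_of_model_balanced`: `2·#{x ∈ D : xg ∈ T₀} = |D|` for all `g`, and `c`
moves a point of `D` off `D`).  `Q₁₆ × C₅`, `Q₃₂ × C₃`, `Q₁₆ × C₇`: no degenerate type among `4000` primitive samples each
(inconclusive).

References: Shimura (1998), §6.2 Thm. 3, §8.2 Prop. 26 [cite: Shimura1998]; Gordon (1999), Thm. 6.4, §9.3
[cite: Gordon1999HodgeAVSurvey].
-/

noncomputable section

open CategoryTheory CategoryTheory.Limits NumberField
open scoped BigOperators

namespace Summit.HodgeConjecture.CorCM.GaloisModels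

open Literature.NumberTheory.ComplexMultiplication
open Literature.AlgebraicGeometry.Motives (AbelianVariety CMType)
open Literature.AlgebraicGeometry.HodgeTheory
open Literature.AlgebraicGeometry.ComplexMultiplication (IsCMTypeRealisation)
open Literature.AlgebraicGeometry.Pohlmann1968
open Literature.Barriers.HodgeConjecture (divisorClassesSpan)
open QuaternionGroup

variable {K : Type} [Field K] [NumberField K] [IsCMField K] [IsGalois ℚ K]

set_option maxRecDepth 8000 in
/-- The central elements of order `≤ 2` of `Q₁₆ × C₃` are `1` and `(a⁴, 1)`. [folklore] -/
theorem central_involution_quaternionSixteen_cyclicThree :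
    ∀ x : QuaternionGroup 4 × Multiplicative (ZMod 3), x * x = 1 → (∀ y, x * y = y * x) →
      x = 1 ∨ x = (a 4, Multiplicative.ofAdd 0) := by
  decide

set_option maxRecDepth 8000 in
/-- **`Gal(K/ℚ) ≅ Q₁₆ × C₃` with complex conjugation `(a⁴, 1)`: a simple DEGENERATE abelian `24`-fold with CM by `K`** (balanced set
of `6` elements moved by `c`), with a rational `(p,p)` class outside the divisor ring on some power.
[cite: Shimura1998, §6.2 Thm. 3 and §8.2 Prop. 26] [cite: Gordon1999HodgeAVSurvey, Thm. 6.4] -/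
theorem exists_simple_degenerate_of_quaternionSixteen_cyclicThree
    (e : (K ≃ₐ[ℚ] K) ≃* QuaternionGroup 4 × Multiplicative (ZMod 3))
    (hc : e ((IsCMField.complexConj K).restrictScalars ℚ) = (a 4, Multiplicative.ofAdd 0)) :
    ∃ (Φ : CMType K) (φ₀ : K →+* ℂ) (A : AbelianVariety ℂ) (ι : 𝓞 K →+* End A)
      (θ : K →+* Module.End ℂ (complexBetti A.X 1)),
      IsPrimitive (ℂ ≃+* ℂ) Φ.1 φ₀ ∧ ¬ IsNondegenerate Φ ∧ IsCMTypeRealisation Φ A ι θ ∧ A.IsSimple ∧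
      A.dim = 24 ∧
      ∃ n p : ℕ, ∃ x : complexBetti (⨁ fun _ : Fin n => A).X (2 * p), IsRationalClass x ∧
        IsOfHodgeType (⨁ fun _ : Fin n => A).dim (⨁ fun _ : Fin n => A).X (2 * p) p p x ∧
        x ∉ divisorClassesSpan (⨁ fun _ : Fin n => A).X (⨁ fun _ : Fin n => A).dim p := by
  have h := exists_simple_degenerate_of_model_balanced e _ hc
    {(a 0, Multiplicative.ofAdd 0), (a 0, Multiplicative.ofAdd 1), (a 0, Multiplicative.ofAdd 2), (a 1, Multiplicative.ofAdd 0),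
      (a 1, Multiplicative.ofAdd 2), (a 2, Multiplicative.ofAdd 0), (a 2, Multiplicative.ofAdd 1), (a 3, Multiplicative.ofAdd 0),
      (a 3, Multiplicative.ofAdd 1), (a 3, Multiplicative.ofAdd 2), (a 5, Multiplicative.ofAdd 1), (a 6, Multiplicative.ofAdd 2),
      (xa 0, Multiplicative.ofAdd 1), (xa 0, Multiplicative.ofAdd 2), (xa 1, Multiplicative.ofAdd 1), (xa 1, Multiplicative.ofAdd 2),
      (xa 2, Multiplicative.ofAdd 0), (xa 2, Multiplicative.ofAdd 2), (xa 3, Multiplicative.ofAdd 2), (xa 4, Multiplicative.ofAdd 0),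
      (xa 5, Multiplicative.ofAdd 0), (xa 6, Multiplicative.ofAdd 1), (xa 7, Multiplicative.ofAdd 0), (xa 7, Multiplicative.ofAdd 1)}
    (by decide) (by decide)
    {(a 0, Multiplicative.ofAdd 2), (a 2, Multiplicative.ofAdd 0), (a 4, Multiplicative.ofAdd 0), (a 6, Multiplicative.ofAdd 1),
      (xa 0, Multiplicative.ofAdd 2), (xa 4, Multiplicative.ofAdd 1)}
    (by decide) (by decide)
  rwa [Fintype.card_prod, QuaternionGroup.card, Fintype.card_multiplicative, ZMod.card] at h

/-- **`Gal(K/ℚ) ≅ Q₁₆ × C₃` is BAD for the (unique) complex conjugation.** [cite: Shimura1998, §6.2 Thm. 3 and §8.2 Prop. 26]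
[cite: Gordon1999HodgeAVSurvey, Thm. 6.4] -/
theorem exists_simple_degenerate_of_mulEquiv_quaternionSixteen_cyclicThree
    (e : (K ≃ₐ[ℚ] K) ≃* QuaternionGroup 4 × Multiplicative (ZMod 3)) :
    ∃ (Φ : CMType K) (φ₀ : K →+* ℂ) (A : AbelianVariety ℂ) (ι : 𝓞 K →+* End A)
      (θ : K →+* Module.End ℂ (complexBetti A.X 1)),
      IsPrimitive (ℂ ≃+* ℂ) Φ.1 φ₀ ∧ ¬ IsNondegenerate Φ ∧ IsCMTypeRealisation Φ A ι θ ∧ A.IsSimple ∧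
      A.dim = 24 ∧
      ∃ n p : ℕ, ∃ x : complexBetti (⨁ fun _ : Fin n => A).X (2 * p), IsRationalClass x ∧
        IsOfHodgeType (⨁ fun _ : Fin n => A).dim (⨁ fun _ : Fin n => A).X (2 * p) p p x ∧
        x ∉ divisorClassesSpan (⨁ fun _ : Fin n => A).X (⨁ fun _ : Fin n => A).dim p := by
  set c₀ := e ((IsCMField.complexConj K).restrictScalars ℚ) with hc₀
  have hcc : c₀ * c₀ = 1 := GaloisRank.model_complexConj_mul_self e rfl
  have hz : ∀ y, c₀ * y = y * c₀ := fun y => GaloisRank.model_complexConj_comm e rfl y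
  have hne : c₀ ≠ 1 := GaloisRank.model_complexConj_ne_one e rfl
  rcases central_involution_quaternionSixteen_cyclicThree c₀ hcc hz with h | h
  · exact absurd h hne
  · exact exists_simple_degenerate_of_quaternionSixteen_cyclicThree e h

end Summit.HodgeConjecture.CorCM.GaloisModels

end
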